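import Summits.Ventures.CertifiedManyBodySolver.Transport.ChainWindowShift
import Literature.MathematicalPhysics.QuantumLattice.WindowEntropyIncrement
import HarnessLib

/-!
# Ventures/CertifiedManyBodySolver — Transport/ChainWindowBlocks.lean

Speedrun cell sr-mbsolver — LIT team (lit-1 gen-6), D-19 r104/r108/r113 (ENT-B0 transport, part 2 of 3).
HONEST FRAMING: first certified bounds; not a superconductivity verdict; every number certified or labelled float.

The DOUBLED WINDOW `W = {-1, …, 2n+3}` of the canonical lane-B window `W' = {-1, …, n+1}` and its three blocks
`A ⊔ S ⊔ B = {-1,…,n} ⊔ {n+1} ⊔ {n+2,…,2n+3}` (Fawzi–Fawzi–Scalet 2024, proof of Thm 4.1: `[1,l−1] × {l} × [l+1,2l−1]`):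
the site identifications `blockEquivY : PolySite W ≃ A ⊕ (Unit ⊕ A)`, `blockEquivAS : PolySite W' ≃ A ⊕ Unit`,
`blockEquivSB : PolySite W' ≃ Unit ⊕ A` (`A = PolySite {-1,…,n}`), and the four block-embedding EQUATIONS
(`blockEquivY_hA/_hAS/_hSB/_hB`) that feed the tree theorem `entropy_increment_nonneg_of_shift_invariant'`
(`Literature/MathematicalPhysics/QuantumLattice/WindowEntropyIncrement.lean`, lit-4): `A ↪ W` and `W' ↪ W` by inclusion,
`S ⊔ B = W' + (n+2)`, `B = A + (n+3)` by translation (`shiftByEmb`). Pure combinatorics of chain windows; no state enters.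
[cite: FawziFawziScalet2024Entropy, Theorem 4.1 (proof)] [cite: KullEtAl2024, §II.B]
-/

noncomputable section

open Matrix Complex Filter Topology
open scoped ComplexOrder
open Literature.Probability.LatticeModels
open Literature.MathematicalPhysics.QuantumLattice
open Literature.MathematicalPhysics.QuantumLattice.HubbardWave0
open Literature.MathematicalPhysics.QuantumLattice.ThermodynamicLimit
open Literature.MathematicalPhysics.QuantumLattice.JordanWigner
open Literature.MathematicalPhysics.QuantumManyBody.StateRelaxation

namespace Summit.Ventures.CertifiedManyBodySolver.Transport

/-! ### The doubled window `{-1, …, 2n+3}` and its three blocks `{-1,…,n} ⊔ {n+1} ⊔ {n+2,…,2n+3}` -/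

section Blocks

/-- Two sites of a chain site set with the same coordinate are equal. [folklore] -/
theorem polySite_eq_of_coord_eq {Λ : Finset (Site 1)} {z z' : PolySite Λ} (h : ofLex z.1 0 = ofLex z'.1 0) : z = z' :=
  Subtype.ext (congrArg toLex (funext fun i => by rw [Subsingleton.elim i 0]; exact h : ofLex z.1 = ofLex z'.1))

variable (n : ℕ)

/-- `{-1,…,n} ⊆ {-1,…,n+1}`. [folklore] -/
theorem entW_sub_left : chainWindow (-1) (n : ℤ) ⊆ chainWindow (-1) ((n : ℤ) + 1) := chainWindow_mono_right (-1) (by omega)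

/-- `{-1,…,n+1} ⊆ {-1,…,2n+3}`. [folklore] -/
theorem entW_sub_mid : chainWindow (-1) ((n : ℤ) + 1) ⊆ chainWindow (-1) (2 * (n : ℤ) + 2 + 1) :=
  chainWindow_mono_right (-1) (by omega)

/-- `{-1,…,n} ⊆ {-1,…,2n+3}`. [folklore] -/
theorem entW_sub_left_big : chainWindow (-1) (n : ℤ) ⊆ chainWindow (-1) (2 * (n : ℤ) + 2 + 1) :=
  chainWindow_mono_right (-1) (by omega)

/-- `{-1,…,n} + (n+3) ⊆ {-1,…,2n+3}`. [folklore] -/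
theorem entW_shift_mem_B : ∀ x ∈ chainWindow (-1) (n : ℤ),
    (fun _ => x 0 + ((n : ℤ) + 3) : Site 1) ∈ chainWindow (-1) (2 * (n : ℤ) + 2 + 1) := by
  intro x hx
  rw [mem_chainWindow] at hx
  simp only [mem_chainWindow]
  omega

/-- `{-1,…,n+1} + (n+2) ⊆ {-1,…,2n+3}`. [folklore] -/
theorem entW_shift_mem_SB : ∀ x ∈ chainWindow (-1) ((n : ℤ) + 1),
    (fun _ => x 0 + ((n : ℤ) + 2) : Site 1) ∈ chainWindow (-1) (2 * (n : ℤ) + 2 + 1) := by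
  intro x hx
  rw [mem_chainWindow] at hx
  simp only [mem_chainWindow]
  omega

/-- `{-1,…,n} + 1 ⊆ {-1,…,n+1}`. [folklore] -/
theorem entW_shift_mem_one : ∀ x ∈ chainWindow (-1) (n : ℤ),
    (fun _ => x 0 + 1 : Site 1) ∈ chainWindow (-1) ((n : ℤ) + 1) := by
  intro x hx
  rw [mem_chainWindow] at hx
  simp only [mem_chainWindow]
  omega

/-- The middle site `n+1 ∈ {-1,…,2n+3}`. [folklore] -/
theorem entW_mid_mem : (fun _ => (n : ℤ) + 1 : Site 1) ∈ chainWindow (-1) (2 * (n : ℤ) + 2 + 1) := by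
  simp only [mem_chainWindow]
  omega

/-- The last site `n+1 ∈ {-1,…,n+1}`. [folklore] -/
theorem entW_last_mem : (fun _ => (n : ℤ) + 1 : Site 1) ∈ chainWindow (-1) ((n : ℤ) + 1) := by
  simp only [mem_chainWindow]
  omega

/-- The first site `-1 ∈ {-1,…,n+1}`. [folklore] -/
theorem entW_first_mem : (fun _ => (-1 : ℤ) : Site 1) ∈ chainWindow (-1) ((n : ℤ) + 1) := by
  simp only [mem_chainWindow]
  omega

/-- **The three-block decomposition of the doubled window** `{-1,…,2n+3} = {-1,…,n} ⊔ {n+1} ⊔ ({-1,…,n} + (n+3))`, as a map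
from the formal sum of the blocks. [cite: FawziFawziScalet2024Entropy, Theorem 4.1 (proof)] -/
def blockMapY : PolySite (chainWindow (-1) (n : ℤ)) ⊕ (Unit ⊕ PolySite (chainWindow (-1) (n : ℤ))) →
    PolySite (chainWindow (-1) (2 * (n : ℤ) + 2 + 1)) :=
  Sum.elim (PolySite.incl (entW_sub_left_big n))
    (Sum.elim (fun _ => PolySite.pt _ (entW_mid_mem n)) (shiftByEmb _ _ ((n : ℤ) + 3) (entW_shift_mem_B n)))

/-- `{-1,…,n+1} = {-1,…,n} ⊔ {n+1}`. [folklore] -/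
def blockMapAS : PolySite (chainWindow (-1) (n : ℤ)) ⊕ Unit → PolySite (chainWindow (-1) ((n : ℤ) + 1)) :=
  Sum.elim (PolySite.incl (entW_sub_left n)) (fun _ => PolySite.pt _ (entW_last_mem n))

/-- `{-1,…,n+1} = {-1} ⊔ ({-1,…,n} + 1)`. [folklore] -/
def blockMapSB : Unit ⊕ PolySite (chainWindow (-1) (n : ℤ)) → PolySite (chainWindow (-1) ((n : ℤ) + 1)) :=
  Sum.elim (fun _ => PolySite.pt _ (entW_first_mem n)) (shiftByEmb _ _ 1 (entW_shift_mem_one n))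

/-- The block map of the doubled window is a bijection. [folklore] -/
theorem blockMapY_bijective : Function.Bijective (blockMapY n) := by
  constructor
  · rintro (y | u | y) (y' | u' | y') h
    · exact congrArg Sum.inl ((PolySite.incl (entW_sub_left_big n)).injective h)
    · have hc := congrArg (fun z : PolySite _ => ofLex z.1 0) h
      have hy := mem_chainWindow.1 (PolySite.ofLex_mem y)
      simp only [blockMapY, Sum.elim_inl, Sum.elim_inr, PolySite.ofLex_coe_pt] at hc
      change ofLex y.1 0 = (n : ℤ) + 1 at hc
      omega
    · have hc := congrArg (fun z : PolySite _ => ofLex z.1 0) h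
      have hy := mem_chainWindow.1 (PolySite.ofLex_mem y)
      have hy' := mem_chainWindow.1 (PolySite.ofLex_mem y')
      change ofLex y.1 0 = ofLex y'.1 0 + ((n : ℤ) + 3) at hc
      omega
    · have hc := congrArg (fun z : PolySite _ => ofLex z.1 0) h
      have hy' := mem_chainWindow.1 (PolySite.ofLex_mem y')
      change (n : ℤ) + 1 = ofLex y'.1 0 at hc
      omega
    · rfl
    · have hc := congrArg (fun z : PolySite _ => ofLex z.1 0) h
      have hy' := mem_chainWindow.1 (PolySite.ofLex_mem y')
      change (n : ℤ) + 1 = ofLex y'.1 0 + ((n : ℤ) + 3) at hc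
      omega
    · have hc := congrArg (fun z : PolySite _ => ofLex z.1 0) h
      have hy := mem_chainWindow.1 (PolySite.ofLex_mem y)
      have hy' := mem_chainWindow.1 (PolySite.ofLex_mem y')
      change ofLex y.1 0 + ((n : ℤ) + 3) = ofLex y'.1 0 at hc
      omega
    · have hc := congrArg (fun z : PolySite _ => ofLex z.1 0) h
      have hy := mem_chainWindow.1 (PolySite.ofLex_mem y)
      change ofLex y.1 0 + ((n : ℤ) + 3) = (n : ℤ) + 1 at hc
      omega
    · have hc := congrArg (fun z : PolySite _ => ofLex z.1 0) h
      change ofLex y.1 0 + ((n : ℤ) + 3) = ofLex y'.1 0 + ((n : ℤ) + 3) at hc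
      exact congrArg (fun w => Sum.inr (Sum.inr w)) (polySite_eq_of_coord_eq (by omega))
  · intro z
    have hz := mem_chainWindow.1 (PolySite.ofLex_mem z)
    by_cases h1 : ofLex z.1 0 ≤ n
    · have hm : ofLex z.1 ∈ chainWindow (-1) (n : ℤ) := mem_chainWindow.2 ⟨hz.1, h1⟩
      exact ⟨Sum.inl (PolySite.pt _ hm), rfl⟩
    · by_cases h2 : ofLex z.1 0 = n + 1
      · refine ⟨Sum.inr (Sum.inl ()), polySite_eq_of_coord_eq ?_⟩
        simp only [blockMapY, Sum.elim_inr, Sum.elim_inl, PolySite.ofLex_coe_pt]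
        omega
      · have hm : (fun _ => ofLex z.1 0 - ((n : ℤ) + 3) : Site 1) ∈ chainWindow (-1) (n : ℤ) := by
          simp only [mem_chainWindow]
          omega
        refine ⟨Sum.inr (Sum.inr (PolySite.pt _ hm)), polySite_eq_of_coord_eq ?_⟩
        simp only [blockMapY, Sum.elim_inr, ofLex_coe_shiftByEmb, PolySite.ofLex_coe_pt]
        omega

/-- The block map of `{-1,…,n+1} = {-1,…,n} ⊔ {n+1}` is a bijection. [folklore] -/
theorem blockMapAS_bijective : Function.Bijective (blockMapAS n) := by
  constructor
  · rintro (y | u) (y' | u') h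
    · exact congrArg Sum.inl ((PolySite.incl (entW_sub_left n)).injective h)
    · have hc := congrArg (fun z : PolySite _ => ofLex z.1 0) h
      have hy := mem_chainWindow.1 (PolySite.ofLex_mem y)
      change ofLex y.1 0 = (n : ℤ) + 1 at hc
      omega
    · have hc := congrArg (fun z : PolySite _ => ofLex z.1 0) h
      have hy' := mem_chainWindow.1 (PolySite.ofLex_mem y')
      change (n : ℤ) + 1 = ofLex y'.1 0 at hc
      omega
    · rfl
  · intro z
    have hz := mem_chainWindow.1 (PolySite.ofLex_mem z)
    by_cases h1 : ofLex z.1 0 ≤ n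
    · have hm : ofLex z.1 ∈ chainWindow (-1) (n : ℤ) := mem_chainWindow.2 ⟨hz.1, h1⟩
      exact ⟨Sum.inl (PolySite.pt _ hm), rfl⟩
    · refine ⟨Sum.inr (), polySite_eq_of_coord_eq ?_⟩
      simp only [blockMapAS, Sum.elim_inr, PolySite.ofLex_coe_pt]
      omega

/-- The block map of `{-1,…,n+1} = {-1} ⊔ ({-1,…,n} + 1)` is a bijection. [folklore] -/
theorem blockMapSB_bijective : Function.Bijective (blockMapSB n) := by
  constructor
  · rintro (u | y) (u' | y') h
    · rfl
    · have hc := congrArg (fun z : PolySite _ => ofLex z.1 0) h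
      have hy' := mem_chainWindow.1 (PolySite.ofLex_mem y')
      change (-1 : ℤ) = ofLex y'.1 0 + 1 at hc
      omega
    · have hc := congrArg (fun z : PolySite _ => ofLex z.1 0) h
      have hy := mem_chainWindow.1 (PolySite.ofLex_mem y)
      change ofLex y.1 0 + 1 = (-1 : ℤ) at hc
      omega
    · have hc := congrArg (fun z : PolySite _ => ofLex z.1 0) h
      change ofLex y.1 0 + 1 = ofLex y'.1 0 + 1 at hc
      exact congrArg Sum.inr (polySite_eq_of_coord_eq (by omega))
  · intro z
    have hz := mem_chainWindow.1 (PolySite.ofLex_mem z)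
    by_cases h1 : ofLex z.1 0 = -1
    · refine ⟨Sum.inl (), polySite_eq_of_coord_eq ?_⟩
      simp only [blockMapSB, Sum.elim_inl, PolySite.ofLex_coe_pt]
      omega
    · have hm : (fun _ => ofLex z.1 0 - 1 : Site 1) ∈ chainWindow (-1) (n : ℤ) := by
        simp only [mem_chainWindow]
        omega
      refine ⟨Sum.inr (PolySite.pt _ hm), polySite_eq_of_coord_eq ?_⟩
      simp only [blockMapSB, Sum.elim_inr, ofLex_coe_shiftByEmb, PolySite.ofLex_coe_pt]
      omega

/-- The doubled window identified with the formal sum of its three blocks. [cite: FawziFawziScalet2024Entropy, Theorem 4.1 (proof)] -/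
def blockEquivY : PolySite (chainWindow (-1) (2 * (n : ℤ) + 2 + 1)) ≃
    PolySite (chainWindow (-1) (n : ℤ)) ⊕ (Unit ⊕ PolySite (chainWindow (-1) (n : ℤ))) :=
  (Equiv.ofBijective _ (blockMapY_bijective n)).symm

/-- `{-1,…,n+1}` identified with `{-1,…,n} ⊔ {n+1}`. [folklore] -/
def blockEquivAS : PolySite (chainWindow (-1) ((n : ℤ) + 1)) ≃ PolySite (chainWindow (-1) (n : ℤ)) ⊕ Unit :=
  (Equiv.ofBijective _ (blockMapAS_bijective n)).symm

/-- `{-1,…,n+1}` identified with `{-1} ⊔ ({-1,…,n} + 1)`. [folklore] -/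
def blockEquivSB : PolySite (chainWindow (-1) ((n : ℤ) + 1)) ≃ Unit ⊕ PolySite (chainWindow (-1) (n : ℤ)) :=
  (Equiv.ofBijective _ (blockMapSB_bijective n)).symm

/-- The inverse identification is the block map. [folklore] -/
@[simp] theorem blockEquivY_symm_apply (u) : (blockEquivY n).symm u = blockMapY n u := rfl

/-- `blockMapAS` inverts `blockEquivAS`. [folklore] -/
@[simp] theorem blockMapAS_blockEquivAS (x) : blockMapAS n (blockEquivAS n x) = x :=
  (Equiv.ofBijective _ (blockMapAS_bijective n)).apply_symm_apply x

/-- `blockMapSB` inverts `blockEquivSB`. [folklore] -/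
@[simp] theorem blockMapSB_blockEquivSB (x) : blockMapSB n (blockEquivSB n x) = x :=
  (Equiv.ofBijective _ (blockMapSB_bijective n)).apply_symm_apply x

end Blocks

/-! ### The four block-embedding equations of `entropy_increment_nonneg_of_shift_invariant'` -/

section BlockEquations

variable (n : ℕ)

/-- Block `A = {-1,…,n}` sits in the doubled window by inclusion. [folklore] -/
theorem blockEquivY_hA : PolySite.incl (entW_sub_left_big n) =
    (Function.Embedding.inl : PolySite (chainWindow (-1) (n : ℤ)) ↪
        PolySite (chainWindow (-1) (n : ℤ)) ⊕ (Unit ⊕ PolySite (chainWindow (-1) (n : ℤ)))).trans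
      (blockEquivY n).symm.toEmbedding :=
  DFunLike.ext _ _ fun _ => rfl

/-- Block `A ⊔ S = {-1,…,n+1}` sits in the doubled window by inclusion. [folklore] -/
theorem blockEquivY_hAS : PolySite.incl (entW_sub_mid n) =
    (((blockEquivAS n).toEmbedding.trans (embAS (PolySite (chainWindow (-1) (n : ℤ))) Unit
        (PolySite (chainWindow (-1) (n : ℤ))))).trans (blockEquivY n).symm.toEmbedding) := by
  refine DFunLike.ext _ _ fun x => ?_
  have hu := blockMapAS_blockEquivAS n x
  simp only [Function.Embedding.trans_apply, Equiv.coe_toEmbedding, blockEquivY_symm_apply]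
  rcases hx : blockEquivAS n x with y | u
  · rw [hx] at hu
    subst hu
    rfl
  · rw [hx] at hu
    subst hu
    rfl

/-- Block `S ⊔ B = {n+1,…,2n+3}` is the translate of `{-1,…,n+1}` by `n+2`. [folklore] -/
theorem blockEquivY_hSB : shiftByEmb _ _ ((n : ℤ) + 2) (entW_shift_mem_SB n) =
    (((blockEquivSB n).toEmbedding.trans (Function.Embedding.inr : Unit ⊕ PolySite (chainWindow (-1) (n : ℤ)) ↪
        PolySite (chainWindow (-1) (n : ℤ)) ⊕ (Unit ⊕ PolySite (chainWindow (-1) (n : ℤ))))).trans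
      (blockEquivY n).symm.toEmbedding) := by
  refine DFunLike.ext _ _ fun x => ?_
  have hu := blockMapSB_blockEquivSB n x
  simp only [Function.Embedding.trans_apply, Equiv.coe_toEmbedding, blockEquivY_symm_apply]
  rcases hx : blockEquivSB n x with u | y
  · rw [hx] at hu
    subst hu
    refine polySite_eq_of_coord_eq ?_
    simp only [ofLex_coe_shiftByEmb, blockMapSB, blockMapY, Function.Embedding.inr_apply, Sum.elim_inl, Sum.elim_inr,
      PolySite.ofLex_coe_pt]
    ring
  · rw [hx] at hu
    subst hu
    refine polySite_eq_of_coord_eq ?_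
    simp only [ofLex_coe_shiftByEmb, blockMapSB, blockMapY, Function.Embedding.inr_apply, Sum.elim_inr]
    ring

/-- Block `B = {n+2,…,2n+3}` is the translate of `{-1,…,n}` by `n+3`. [folklore] -/
theorem blockEquivY_hB : shiftByEmb _ _ ((n : ℤ) + 3) (entW_shift_mem_B n) =
    (embB (PolySite (chainWindow (-1) (n : ℤ))) Unit (PolySite (chainWindow (-1) (n : ℤ)))).trans
      (blockEquivY n).symm.toEmbedding :=
  DFunLike.ext _ _ fun _ => rfl

end BlockEquations

end Summit.Ventures.CertifiedManyBodySolver.Transport
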